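import Literature.NumberTheory.Rogawski1990.ArchInnerTransferJunction               -- ★ (11) the junction at a diagonal frame
import Literature.NumberTheory.Rogawski1990.ArchInnerTransferOneSystemCongruence    -- ★ (S0) the one-system sentence carried by a congruence
import HarnessLib

/-!
# The junction of the archimedean inner-form transfer at a general inner form (N8-INNER brick (11) ∘ adapter (S0))

Topic `NumberTheory/Rogawski1990`; namespace `Literature.NumberTheory.Rogawski1990`.  THEOREMS ONLY (no `def`, no instance, no notation,
no axiom, no named fact, no `sorry`).

For an anisotropic hermitian `H` congruent over `L ⊗ ℝ` to a diagonal frame, `Θ : U(diag α)_∞ ≃ₜ* U(H)_∞`, `Θ g = T′ g T′⁻¹`, and the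
quasi-split congruence `Φ : U(Φ₃)_∞ ≃ₜ* U(diag β₀)_∞`, `Φ g = T g T⁻¹`, print's one-system sentence at `(H, Φ₃, ν′, ν)` —
a compatible Weil-form system with the `C_c^∞` inner transfer (14.2.1) [Rogawski1990, §14.2 p. 233] — follows from the STABLE SURJECTION on
the quasi-split atlas read at the diagonal frame `(diag α, ν′.map Θ⁻¹)` (★ `exists_archCompatibleFamiliesG_and_isArchInnerTransferExists_of_stableSurjG`)
by transport along `Θ` (★ `exists_archCompatibleFamiliesG_and_isArchInnerTransferExists_transport`).

* `isMulRightInvariant_map_archCongr_of_isMulRightInvariant` — right invariance is carried by any congruence `U(H₂)_∞ ≃ₜ* U(H)_∞` (any `N`).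
* `exists_archCompatibleFamiliesG_and_isArchInnerTransferExists_of_stableSurjG_of_archCongr` — the sentence at `H`.

HONEST LABEL.  Nothing here asserts the stable surjection; HC_CM is proved only modulo the printed citations until rung 0 closes.

## References
* [Rogawski1990] J. D. Rogawski, *Automorphic Representations of Unitary Groups in Three Variables*, Ann. of Math. Stud. 123 (1990), §1.7 p. 6,
  §14.1 p. 232, §14.2 (14.2.1) pp. 232–233.
* [Shelstad1979] D. Shelstad, *Characters and inner forms of a quasi-split group over ℝ*, Compositio Math. 39 (1979) 11–45, §4 p. 20, Thm. 4.1 p. 21.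
-/

set_option autoImplicit false

noncomputable section

open MeasureTheory MeasureTheory.Measure NumberField NumberField.InfinitePlace Matrix Complex Topology Finset
open Literature.MeasureTheory.Group
open scoped MatrixGroups Matrix Classical NNReal ENNReal

namespace Literature.NumberTheory.Rogawski1990

open Literature.NumberTheory.Automorphic Literature.NumberTheory.Automorphic.UnitaryGroup Literature.NumberTheory.Automorphic.ArchCartan

section Haar

variable (L : Type) [Field L] [NumberField L] [IsCMField L] {N : ℕ} {H H₂ : Matrix (Fin N) (Fin N) L}
  [MeasurableSpace ↥(arch (↥(maximalRealSubfield L)) L (IsCMField.complexConj L) N H)]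
  [BorelSpace ↥(arch (↥(maximalRealSubfield L)) L (IsCMField.complexConj L) N H)]
  [MeasurableSpace ↥(arch (↥(maximalRealSubfield L)) L (IsCMField.complexConj L) N H₂)]
  [BorelSpace ↥(arch (↥(maximalRealSubfield L)) L (IsCMField.complexConj L) N H₂)]

/-- Right invariance of a measure on `U(H₂)(L ⊗ ℝ)` is carried to its image under any topological group isomorphism
`Θ : U(H₂)(L ⊗ ℝ) ≃ₜ* U(H)(L ⊗ ℝ)` (the Haar property is Mathlib's instance `ContinuousMulEquiv.isHaarMeasure_map`). [cite: Rogawski1990, §1.7 p. 6] -/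
theorem isMulRightInvariant_map_archCongr_of_isMulRightInvariant
    (Θ : ↥(arch (↥(maximalRealSubfield L)) L (IsCMField.complexConj L) N H₂) ≃ₜ* ↥(arch (↥(maximalRealSubfield L)) L (IsCMField.complexConj L) N H))
    (μ : Measure ↥(arch (↥(maximalRealSubfield L)) L (IsCMField.complexConj L) N H₂)) [μ.IsMulRightInvariant] :
    (Measure.map Θ μ).IsMulRightInvariant := by
  refine ⟨fun h => ?_⟩
  have he : Measurable (Θ : ↥(arch (↥(maximalRealSubfield L)) L (IsCMField.complexConj L) N H₂) →
      ↥(arch (↥(maximalRealSubfield L)) L (IsCMField.complexConj L) N H)) := Θ.continuous.measurable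
  obtain ⟨g, rfl⟩ := Θ.surjective h
  rw [Measure.map_map (measurable_mul_const _) he]
  conv_rhs => rw [← map_mul_right_eq_self μ g]
  rw [Measure.map_map he (measurable_mul_const _)]
  have hcomp : (fun x => x * Θ g) ∘ (Θ : ↥(arch (↥(maximalRealSubfield L)) L (IsCMField.complexConj L) N H₂) →
      ↥(arch (↥(maximalRealSubfield L)) L (IsCMField.complexConj L) N H)) = Θ ∘ fun x => x * g := by
    funext x
    simp only [Function.comp_apply, map_mul]
  rw [hcomp]

end Haar

section General

variable (L : Type) [Field L] [NumberField L] [IsCMField L] {H : Matrix (Fin 3) (Fin 3) L} (α : Fin 3 → L)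
  [MeasurableSpace ↥(arch (↥(maximalRealSubfield L)) L (IsCMField.complexConj L) 3 H)]
  [BorelSpace ↥(arch (↥(maximalRealSubfield L)) L (IsCMField.complexConj L) 3 H)]
  [MeasurableSpace ↥(arch (↥(maximalRealSubfield L)) L (IsCMField.complexConj L) 3 (Matrix.diagonal α))]
  [BorelSpace ↥(arch (↥(maximalRealSubfield L)) L (IsCMField.complexConj L) 3 (Matrix.diagonal α))]
  [MeasurableSpace ↥(arch (↥(maximalRealSubfield L)) L (IsCMField.complexConj L) 3
      (Matrix.of fun i j : Fin 3 => if i.val + j.val + 1 = 3 then (1 : L) else 0))]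
  [BorelSpace ↥(arch (↥(maximalRealSubfield L)) L (IsCMField.complexConj L) 3
      (Matrix.of fun i j : Fin 3 => if i.val + j.val + 1 = 3 then (1 : L) else 0))]
  [MeasurableSpace ↥(arch (↥(maximalRealSubfield L)) L (IsCMField.complexConj L) 3 (Matrix.diagonal ![(2 : L)⁻¹, 1, -(2 : L)⁻¹]))]
  [BorelSpace ↥(arch (↥(maximalRealSubfield L)) L (IsCMField.complexConj L) 3 (Matrix.diagonal ![(2 : L)⁻¹, 1, -(2 : L)⁻¹]))]
  (ν' : Measure ↥(arch (↥(maximalRealSubfield L)) L (IsCMField.complexConj L) 3 H))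
  (ν : Measure ↥(arch (↥(maximalRealSubfield L)) L (IsCMField.complexConj L) 3
      (Matrix.of fun i j : Fin 3 => if i.val + j.val + 1 = 3 then (1 : L) else 0)))
  [ν'.IsHaarMeasure] [ν'.IsMulRightInvariant] [ν.IsHaarMeasure] [ν.IsMulRightInvariant]

/-- **THE JUNCTION AT A GENERAL INNER FORM.**  `H` anisotropic hermitian, `Θ : U(diag α)_∞ ≃ₜ* U(H)_∞` an ambient congruence (`Θ g = T′ g T′⁻¹`),
`Φ : U(Φ₃)_∞ ≃ₜ* U(diag β₀)_∞` the quasi-split congruence (`Φ g = T g T⁻¹`): the stable surjection on the quasi-split atlas, read at the diagonal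
frame `(diag α, ν′.map Θ⁻¹, ν.map Φ)`, gives print's one-system sentence at `(H, Φ₃, ν′, ν)` — a compatible Weil-form system (★ `ArchCompatibleFamiliesG`)
with the `C_c^∞` inner transfer (14.2.1) (★ `IsArchInnerTransferExists`).  Composition of ★ `exists_archCompatibleFamiliesG_and_isArchInnerTransferExists_of_stableSurjG`
(at `diag α`) with ★ `exists_archCompatibleFamiliesG_and_isArchInnerTransferExists_transport` (along `Θ`, `ν′ = (ν′.map Θ⁻¹).map Θ`).
[cite: Rogawski1990, §14.2 (14.2.1) pp. 232–233; §1.7 p. 6; §14.1 p. 232] [cite: Shelstad1979, §4 p. 20, Thm. 4.1 (p. 21)] -/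
theorem exists_archCompatibleFamiliesG_and_isArchInnerTransferExists_of_stableSurjG_of_archCongr
    (T' : GL (Fin 3) (mixedEmbedding.mixedSpace L))
    (Θ : ↥(arch (↥(maximalRealSubfield L)) L (IsCMField.complexConj L) 3 (Matrix.diagonal α)) ≃ₜ*
      ↥(arch (↥(maximalRealSubfield L)) L (IsCMField.complexConj L) 3 H))
    (hΘ : ∀ g : ↥(arch (↥(maximalRealSubfield L)) L (IsCMField.complexConj L) 3 (Matrix.diagonal α)),
      ((Θ g : ↥(arch (↥(maximalRealSubfield L)) L (IsCMField.complexConj L) 3 H)) : GL (Fin 3) (mixedEmbedding.mixedSpace L)) =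
        T' * (g : GL (Fin 3) (mixedEmbedding.mixedSpace L)) * T'⁻¹)
    [(Measure.map Θ.symm ν').IsMulRightInvariant]
    (T : GL (Fin 3) (mixedEmbedding.mixedSpace L))
    (Φ : ↥(arch (↥(maximalRealSubfield L)) L (IsCMField.complexConj L) 3
        (Matrix.of fun i j : Fin 3 => if i.val + j.val + 1 = 3 then (1 : L) else 0)) ≃ₜ*
          ↥(arch (↥(maximalRealSubfield L)) L (IsCMField.complexConj L) 3 (Matrix.diagonal ![(2 : L)⁻¹, 1, -(2 : L)⁻¹])))
    (hΦ : ∀ g : ↥(arch (↥(maximalRealSubfield L)) L (IsCMField.complexConj L) 3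
        (Matrix.of fun i j : Fin 3 => if i.val + j.val + 1 = 3 then (1 : L) else 0)),
      ((Φ g : ↥(arch (↥(maximalRealSubfield L)) L (IsCMField.complexConj L) 3 (Matrix.diagonal ![(2 : L)⁻¹, 1, -(2 : L)⁻¹]))) :
          GL (Fin 3) (mixedEmbedding.mixedSpace L)) =
        T * (g : GL (Fin 3) (mixedEmbedding.mixedSpace L)) * T⁻¹)
    [(Measure.map Φ ν).IsHaarMeasure] [(Measure.map Φ ν).IsMulRightInvariant]
    (hα : ∀ i, α i ≠ 0) (hherm : ∀ i, (IsCMField.complexConj L (α i) : L) = α i)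
    (hanisα : ∀ x : Fin 3 → L, Literature.AlgebraicGeometry.ShimuraVarieties.hermForm (cmConjRingHom L) (Matrix.diagonal α) x x = 0 → x = 0)
    (hanis : ∀ x : Fin 3 → L, Literature.AlgebraicGeometry.ShimuraVarieties.hermForm (cmConjRingHom L) H x x = 0 → x = 0)
    (hSurj : ∀ a' : ↥(arch (↥(maximalRealSubfield L)) L (IsCMField.complexConj L) 3 (Matrix.diagonal α)) → ℂ,
      ArchSmooth L 3 (Matrix.diagonal α) a' →
        ∃ f : ↥(arch (↥(maximalRealSubfield L)) L (IsCMField.complexConj L) 3 (Matrix.diagonal ![(2 : L)⁻¹, 1, -(2 : L)⁻¹])) → ℂ,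
          ArchSmooth L 3 (Matrix.diagonal ![(2 : L)⁻¹, 1, -(2 : L)⁻¹]) f ∧
            ∀ (S : Finset {w : InfinitePlace L // IsComplex w}) (c : {w : InfinitePlace L // IsComplex w} → Fin 3 → ℝ),
              c ∈ RegG S →
                stableSumG (orbFamGExt L ![(2 : L)⁻¹, 1, -(2 : L)⁻¹] (Measure.map Φ ν) f) S c =
                  stableSumG (fun S' c' => (∏ _w ∈ Finset.univ.filter (fun w => ¬ IsIndefiniteAt (slotSign L α) w), (3 : ℂ)⁻¹) *
                    orbFamGExt L α (Measure.map Θ.symm ν') a' S' c') S c) :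
    letI : ∀ γ : ↥(arch (↥(maximalRealSubfield L)) L (IsCMField.complexConj L) 3 H),
        MeasurableSpace (↥(arch (↥(maximalRealSubfield L)) L (IsCMField.complexConj L) 3 H) ⧸
          Subgroup.centralizer ({γ} : Set ↥(arch (↥(maximalRealSubfield L)) L (IsCMField.complexConj L) 3 H))) :=
      fun _ => borel _
    haveI : ∀ γ : ↥(arch (↥(maximalRealSubfield L)) L (IsCMField.complexConj L) 3 H),
        BorelSpace (↥(arch (↥(maximalRealSubfield L)) L (IsCMField.complexConj L) 3 H) ⧸
          Subgroup.centralizer ({γ} : Set ↥(arch (↥(maximalRealSubfield L)) L (IsCMField.complexConj L) 3 H))) :=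
      fun _ => ⟨rfl⟩
    letI : ∀ γ : ↥(arch (↥(maximalRealSubfield L)) L (IsCMField.complexConj L) 3
          (Matrix.of fun i j : Fin 3 => if i.val + j.val + 1 = 3 then (1 : L) else 0)),
        MeasurableSpace (↥(arch (↥(maximalRealSubfield L)) L (IsCMField.complexConj L) 3
            (Matrix.of fun i j : Fin 3 => if i.val + j.val + 1 = 3 then (1 : L) else 0)) ⧸
          Subgroup.centralizer ({γ} : Set ↥(arch (↥(maximalRealSubfield L)) L (IsCMField.complexConj L) 3
            (Matrix.of fun i j : Fin 3 => if i.val + j.val + 1 = 3 then (1 : L) else 0)))) :=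
      fun _ => borel _
    haveI : ∀ γ : ↥(arch (↥(maximalRealSubfield L)) L (IsCMField.complexConj L) 3
          (Matrix.of fun i j : Fin 3 => if i.val + j.val + 1 = 3 then (1 : L) else 0)),
        BorelSpace (↥(arch (↥(maximalRealSubfield L)) L (IsCMField.complexConj L) 3
            (Matrix.of fun i j : Fin 3 => if i.val + j.val + 1 = 3 then (1 : L) else 0)) ⧸
          Subgroup.centralizer ({γ} : Set ↥(arch (↥(maximalRealSubfield L)) L (IsCMField.complexConj L) 3
            (Matrix.of fun i j : Fin 3 => if i.val + j.val + 1 = 3 then (1 : L) else 0)))) :=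
      fun _ => ⟨rfl⟩
    ∃ (m' : OrbitalMeasureFamily ↥(arch (↥(maximalRealSubfield L)) L (IsCMField.complexConj L) 3 H))
      (m : OrbitalMeasureFamily ↥(arch (↥(maximalRealSubfield L)) L (IsCMField.complexConj L) 3
        (Matrix.of fun i j : Fin 3 => if i.val + j.val + 1 = 3 then (1 : L) else 0)))
      (t' : ∀ γ' : ↥(arch (↥(maximalRealSubfield L)) L (IsCMField.complexConj L) 3 H),
        Measure (Subgroup.centralizer ({γ'} : Set ↥(arch (↥(maximalRealSubfield L)) L (IsCMField.complexConj L) 3 H))))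
      (t : ∀ γ : ↥(arch (↥(maximalRealSubfield L)) L (IsCMField.complexConj L) 3
          (Matrix.of fun i j : Fin 3 => if i.val + j.val + 1 = 3 then (1 : L) else 0)),
        Measure (Subgroup.centralizer ({γ} : Set ↥(arch (↥(maximalRealSubfield L)) L (IsCMField.complexConj L) 3
          (Matrix.of fun i j : Fin 3 => if i.val + j.val + 1 = 3 then (1 : L) else 0))))),
      ArchCompatibleFamiliesG L H ν' ν hanis m' m t' t ∧
        IsArchInnerTransferExists L H m' m (ArchSmooth L 3 H)
          (ArchSmooth L 3 (Matrix.of fun i j : Fin 3 => if i.val + j.val + 1 = 3 then (1 : L) else 0)) := by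
  have hν : ν' = Measure.map Θ (Measure.map Θ.symm ν') := by
    have h1 : Measurable (Θ : ↥(arch (↥(maximalRealSubfield L)) L (IsCMField.complexConj L) 3 (Matrix.diagonal α)) →
        ↥(arch (↥(maximalRealSubfield L)) L (IsCMField.complexConj L) 3 H)) := Θ.continuous.measurable
    have h2 : Measurable (Θ.symm : ↥(arch (↥(maximalRealSubfield L)) L (IsCMField.complexConj L) 3 H) →
        ↥(arch (↥(maximalRealSubfield L)) L (IsCMField.complexConj L) 3 (Matrix.diagonal α))) := Θ.symm.continuous.measurable
    rw [Measure.map_map h1 h2]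
    have hid : (Θ : ↥(arch (↥(maximalRealSubfield L)) L (IsCMField.complexConj L) 3 (Matrix.diagonal α)) →
        ↥(arch (↥(maximalRealSubfield L)) L (IsCMField.complexConj L) 3 H)) ∘
        (Θ.symm : ↥(arch (↥(maximalRealSubfield L)) L (IsCMField.complexConj L) 3 H) →
          ↥(arch (↥(maximalRealSubfield L)) L (IsCMField.complexConj L) 3 (Matrix.diagonal α))) = id := by
      funext x
      simp
    rw [hid, Measure.map_id]
  exact exists_archCompatibleFamiliesG_and_isArchInnerTransferExists_transport L (Measure.map Θ.symm ν') ν' ν T' Θ hΘ hν hanisα hanis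
    (exists_archCompatibleFamiliesG_and_isArchInnerTransferExists_of_stableSurjG L α (Measure.map Θ.symm ν') ν T Φ hΦ hα hherm hanisα hSurj)

end General

end Literature.NumberTheory.Rogawski1990

end
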